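import Summits.RiemannHypothesis.RiemannHypothesis.Theses.WeilWindowFlow
import Summits.RiemannHypothesis.RiemannHypothesis.Theorems.WeilWindowFlowWindowLipschitz
import Summits.RiemannHypothesis.RiemannHypothesis.Theorems.WeilWindowFlowStrictUnderRH
import Summits.RiemannHypothesis.RiemannHypothesis.Theorems.WeilWindowFlowGronwallLeakageStrictAntiFlow
import Summits.RiemannHypothesis.RiemannHypothesis.Theorems.WeilWindowFlowGronwallLeakageIffRH
import Summits.RiemannHypothesis.RiemannHypothesis.Theorems.WeilWindowFlowDiniLeakageCalibration
import Summits.RiemannHypothesis.RiemannHypothesis.Theorems.WeilWindowFlowLipschitzDerivGlue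

/-!
# Calibration of crux `WeilWindowFlow.DerivLeakage` (item stmt-RiemannHypothesis-14754) and of the
# Hölder-relative ladder between `WindowLipschitz` (item 1039, PROVED) and the relative leakage law

Route `WeilWindowFlow`, `ε = weilGroundEnergy` (the bottom of Weil's form on the window `[-a, a]`).
Def-free port of the forward seat's kernel certificate `bc/HolderLeakage_flat.lean`
(planner-fwd-rung-RiemannHypothesis-02, 2026-08-17, sorry-free) completed at the two ends of the ladder;
filed for landing by the harvest seat planner-fwd-harvest-RiemannHypothesis-02 (`--supports` item 14754).
A CRITERION / NEGATIVE-KNOWLEDGE file: nothing here attacks the crux; it records exactly what each statement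
of the family is worth.

The **Hölder-relative leakage law with exponent `θ`** is
`H(θ) : ∀ b₀ A, 0 < b₀ → b₀ ≤ A → ∃ L, ∀ b a, b₀ ≤ b → b ≤ a → a ≤ A → ε b − ε a ≤ L (a − b) · (max |ε b| |ε a|) ^ θ`
(written out verbatim in every statement below; no new definitions are introduced).
`H(0)` is literally the proved crux `WindowLipschitz`; `H(1)` is the relative (Grönwall-rate) law whose
pointwise-derivative form is the open crux `DerivLeakage`.  What is proved:

* `derivLeakage_of_summit`, `summit_of_derivLeakage` (the two edges Statement ⇄ item 14754),
  `riemannHypothesis_of_derivLeakage`, `derivLeakage_iff_riemannHypothesis`, `derivLeakage_iff_summit`,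
  `derivLeakage_iff_diniLeakage`, `derivLeakage_iff_gronwallLeakage` — **item 14754 is exactly the Riemann
  hypothesis** (given the landed `WindowLipschitz_proof`, `strictUnderRH_proof`, `lipschitzDerivGlue_proof` and
  the `DiniLeakage` calibration), hence equivalent BY NAME to the two other open cruxes of the route;
* `holderLaw_zero_iff_windowLipschitz`, `holderLaw_zero` — the floor `θ = 0` is item 1039 (PROVED);
* `holderLaw_of_riemannHypothesis` — `RH → H(θ)` for every `θ ≥ 0` (every rung is a consequence of S);
* `riemannHypothesis_of_holderLaw_of_one_le` — for `θ ≥ 1`, `H(θ) → RH` UNCONDITIONALLY (at a conjugate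
  point `a⋆`, `ε(a⋆ − h) ≤ L h ε(a⋆ − h)^θ ≤ L h ε(a⋆ − h)` forces `1 ≤ L h`); so `H(θ) ↔ RH ↔ DerivLeakage`
  for `θ ≥ 1` (`holderLaw_iff_riemannHypothesis_of_one_le`, `holderLaw_iff_derivLeakage_of_one_le`);
* `riemannHypothesis_of_holderLaw_of_transversal` — for `0 < θ < 1`, `H(θ) → RH` MODULO transversality of
  conjugate points (`ε a = 0 ⟹ ε(a − h) ≥ c h` eventually; = Sub_0 `ConjugatePointsTransversal` of
  Cruxes/GronwallLeakage/StrategyCensus.lean): `c h ≤ ε(a⋆ − h) ≤ L h ε(a⋆ − h)^θ` gives `c^{1−θ} ≤ L h^θ → 0`;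
  so `H(θ) ↔ RH` modulo Sub_0 (`holderLaw_iff_riemannHypothesis_of_transversal`);
* `transversal_of_coLipschitz` — a positive lower slope of `ε` on compact ranges (local co-Lipschitz /
  quantitative strict antitonicity, NOT known even under RH) discharges Sub_0, whence
  `riemannHypothesis_of_holderLaw_of_coLipschitz`.

Upshot for planners (ladder census): the θ-ladder over the proved floor `WindowLipschitz` is FLAT — every
rung `θ > 0` is RH-strength (outright for `θ ≥ 1`, modulo Sub_0 for `θ < 1`); no statement of this family is
an intermediate target.  Axioms ⊆ {propext, Classical.choice, Quot.sound}.
-/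

set_option linter.dupNamespace false

noncomputable section

open Set Filter Topology MeasureTheory

namespace Summit.RiemannHypothesis.RiemannHypothesis.Theorems.WeilWindowFlowDerivLeakage

open _root_.Literature.NumberTheory.LFunctions
open _root_.Summit.RiemannHypothesis.RiemannHypothesis.Theses.WeilWindowFlow
open _root_.Summit.RiemannHypothesis.RiemannHypothesis.Theorems.WeilWindowFlowWindowLipschitz
  (WindowLipschitz_proof windowLipschitz_antitone)
open _root_.Summit.RiemannHypothesis.RiemannHypothesis.Theorems.WeilWindowFlowGronwallLeakage
  (exists_conjugatePoint_sharp_of_not_riemannHypothesis gronwallLeakage_iff_riemannHypothesis)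
open _root_.Summit.RiemannHypothesis.RiemannHypothesis.Theorems (strictUnderRH_proof)
open _root_.Summit.RiemannHypothesis.RiemannHypothesis.Theorems.WeilWindowFlowDiniLeakage
  (riemannHypothesis_of_diniLeakage diniLeakage_iff_riemannHypothesis_and_windowLipschitz)
open _root_.Summit.RiemannHypothesis.RiemannHypothesis.Theorems.WeilWindowFlowLipschitzDerivGlue
  (lipschitzDerivGlue_proof)

local notation "ε" => weilGroundEnergy

/-! ## 1. Real-analysis core: a left drop bound controls the derivative -/

/-- If `f b − f a ≤ M (a − b)` for all `b ∈ [c, a)` (`c < a`) and `f` is differentiable at `a`, then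
`−f′(a) ≤ M` (left slopes of `f` at `a` are `≥ −M`, and they converge to `f′(a)`). [folklore] -/
theorem neg_deriv_le_of_left_drop_le {f : ℝ → ℝ} {c a M : ℝ} (hca : c < a)
    (hf : DifferentiableAt ℝ f a) (h : ∀ b : ℝ, c ≤ b → b < a → f b - f a ≤ M * (a - b)) :
    -deriv f a ≤ M := by
  have ht : Tendsto (slope f a) (𝓝[<] a) (𝓝 (deriv f a)) :=
    hf.hasDerivAt.tendsto_slope.mono_left (nhdsLT_le_nhdsNE a)
  have hev : ∀ᶠ b in 𝓝[<] a, -M ≤ slope f a b := by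
    filter_upwards [Ioo_mem_nhdsLT hca] with b hb
    rw [slope_def_field, le_div_iff_of_neg (sub_neg.2 hb.2)]
    have := h b hb.1.le hb.2
    nlinarith
  linarith [ge_of_tendsto ht hev]

/-! ## 2. Item 14754 `DerivLeakage` is exactly the Riemann hypothesis -/

/-- **S ⟹ crux.** Under the summit statement every bottom is positive (`strictUnderRH_proof`, item 1043)
and `ε` is antitone, so on `[b₀, A]` one has `ε a ≥ ε A > 0`; the PROVED one-sided Lipschitz bound on
`[b₀/2, A]` (`WindowLipschitz_proof`, item 1039) bounds `−ε′(a) ≤ max L 0` at every differentiability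
point (`neg_deriv_le_of_left_drop_le`), hence `−ε′(a) ≤ (max L 0 / ε A) · ε a`. [folklore] -/
theorem derivLeakage_of_summit (hS : _root_.Summit.RiemannHypothesis) : DerivLeakage := by
  intro b₀ A hb₀ hA
  obtain ⟨L, hL⟩ := WindowLipschitz_proof (b₀ / 2) A (by positivity) (by linarith)
  have hApos : 0 < A := hb₀.trans_le hA
  have hm : 0 < ε A := strictUnderRH_proof hS A hApos
  refine ⟨max L 0 / ε A, fun a hba haA _ hdiff ↦ ?_⟩
  have ha0 : 0 < a := hb₀.trans_le hba
  have key : -deriv weilGroundEnergy a ≤ max L 0 :=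
    neg_deriv_le_of_left_drop_le (c := b₀ / 2) (by linarith) hdiff fun b hb hblt ↦
      (hL b a hb hblt.le haA).trans (mul_le_mul_of_nonneg_right (le_max_left _ _) (by linarith))
  have hεa : ε A ≤ ε a := windowLipschitz_antitone ha0 haA
  calc -deriv weilGroundEnergy a ≤ max L 0 := key
    _ = max L 0 / ε A * ε A := by field_simp
    _ ≤ max L 0 / ε A * ε a :=
        mul_le_mul_of_nonneg_left hεa (div_nonneg (le_max_right _ _) hm.le)

/-- **Crux ⟹ RH**: `DerivLeakage` with the PROVED `WindowLipschitz` gives `DiniLeakage`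
(`lipschitzDerivGlue_proof`, item 14755), which decides RH (`riemannHypothesis_of_diniLeakage`, landed
calibration of item 1038). [folklore] -/
theorem riemannHypothesis_of_derivLeakage (hD : DerivLeakage) : _root_.RiemannHypothesis :=
  riemannHypothesis_of_diniLeakage (lipschitzDerivGlue_proof WindowLipschitz_proof hD)

/-- **Crux ⟹ S** at summit level: `DerivLeakage → Summit.RiemannHypothesis` (the edge item 14754 → Statement,
through items 1039, 14755 and the calibration of 1038). [folklore] -/
theorem summit_of_derivLeakage (hD : DerivLeakage) : _root_.Summit.RiemannHypothesis :=
  (_root_.Summit.RiemannHypothesis_iff).2 (riemannHypothesis_of_derivLeakage hD)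

/-- **Item 14754 is the Riemann hypothesis verbatim**: `DerivLeakage ↔ RiemannHypothesis` (Mathlib's
statement; `Summit.RiemannHypothesis_iff : Summit.RiemannHypothesis ↔ RiemannHypothesis`). [folklore] -/
theorem derivLeakage_iff_riemannHypothesis : DerivLeakage ↔ _root_.RiemannHypothesis :=
  ⟨riemannHypothesis_of_derivLeakage,
    fun h ↦ derivLeakage_of_summit ((_root_.Summit.RiemannHypothesis_iff).2 h)⟩

/-- Summit-level form: `DerivLeakage ↔ Summit.RiemannHypothesis`. [folklore] -/
theorem derivLeakage_iff_summit : DerivLeakage ↔ _root_.Summit.RiemannHypothesis := by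
  rw [derivLeakage_iff_riemannHypothesis, _root_.Summit.RiemannHypothesis_iff]

/-- The rank-2 crux and its "RH-strength half" coincide: `DerivLeakage ↔ DiniLeakage` (items 14754, 1038),
by `lipschitzDerivGlue_proof` + `WindowLipschitz_proof` one way and the landed calibration
`DiniLeakage ↔ RH ∧ WindowLipschitz` the other. [folklore] -/
theorem derivLeakage_iff_diniLeakage : DerivLeakage ↔ DiniLeakage :=
  ⟨fun hD ↦ lipschitzDerivGlue_proof WindowLipschitz_proof hD,
    fun hD ↦ derivLeakage_iff_riemannHypothesis.2 (riemannHypothesis_of_diniLeakage hD)⟩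

/-- All three open cruxes of route WeilWindowFlow are one statement: `DerivLeakage ↔ GronwallLeakage`
(items 14754, 1037; through `gronwallLeakage_iff_riemannHypothesis`). [folklore] -/
theorem derivLeakage_iff_gronwallLeakage : DerivLeakage ↔ GronwallLeakage := by
  rw [derivLeakage_iff_riemannHypothesis, gronwallLeakage_iff_riemannHypothesis]

/-! ## 3. The Hölder-relative ladder `H(θ)`: the floor `θ = 0` is item 1039 (PROVED) -/

/-- `H(0)` is literally the crux `WindowLipschitz` (item 1039): `(max |ε b| |ε a|) ^ (0:ℝ) = 1`. [folklore] -/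
theorem holderLaw_zero_iff_windowLipschitz :
    (∀ b₀ A : ℝ, 0 < b₀ → b₀ ≤ A → ∃ L : ℝ, ∀ b a : ℝ, b₀ ≤ b → b ≤ a → a ≤ A →
      ε b - ε a ≤ L * (a - b) * max |ε b| |ε a| ^ (0 : ℝ)) ↔ WindowLipschitz := by
  simp only [Real.rpow_zero, mul_one]
  rfl

/-- **The floor is a theorem**: `H(0)` holds (`WindowLipschitz_proof`, item 1039, landed). This is the
witness that pins the family to proved ground. [folklore] -/
theorem holderLaw_zero :
    ∀ b₀ A : ℝ, 0 < b₀ → b₀ ≤ A → ∃ L : ℝ, ∀ b a : ℝ, b₀ ≤ b → b ≤ a → a ≤ A →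
      ε b - ε a ≤ L * (a - b) * max |ε b| |ε a| ^ (0 : ℝ) :=
  holderLaw_zero_iff_windowLipschitz.2 WindowLipschitz_proof

/-! ## 4. `S ⟹ H(θ)` for every `θ ≥ 0` -/

/-- **RH ⟹ H(θ)** (`θ ≥ 0`): under RH the bottom is positive (`strictUnderRH_proof`) and antitone, so on
`[b₀, A]` `max |ε b| |ε a| ≥ ε A > 0` and the floor's constant can be divided by `(ε A)^θ`. [folklore] -/
theorem holderLaw_of_riemannHypothesis {θ : ℝ} (hθ : 0 ≤ θ) (hRH : _root_.RiemannHypothesis) :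
    ∀ b₀ A : ℝ, 0 < b₀ → b₀ ≤ A → ∃ L : ℝ, ∀ b a : ℝ, b₀ ≤ b → b ≤ a → a ≤ A →
      ε b - ε a ≤ L * (a - b) * max |ε b| |ε a| ^ θ := by
  intro b₀ A hb₀ hA
  obtain ⟨L, hL⟩ := WindowLipschitz_proof b₀ A hb₀ hA
  have hApos : 0 < A := hb₀.trans_le hA
  have hm : 0 < ε A := strictUnderRH_proof ((_root_.Summit.RiemannHypothesis_iff).2 hRH) A hApos
  have hmθ : 0 < ε A ^ θ := Real.rpow_pos_of_pos hm θ
  refine ⟨max L 0 / ε A ^ θ, fun b a hb hba haA ↦ ?_⟩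
  have hb0 : 0 < b := hb₀.trans_le hb
  have ha0 : 0 < a := hb0.trans_le hba
  have h1 := hL b a hb hba haA
  have hεa : ε A ≤ ε a := windowLipschitz_antitone ha0 haA
  have hmax : ε A ^ θ ≤ max |ε b| |ε a| ^ θ := by
    apply Real.rpow_le_rpow hm.le _ hθ
    exact le_trans (hεa.trans (le_abs_self _)) (le_max_right _ _)
  have hab : 0 ≤ a - b := sub_nonneg.2 hba
  calc ε b - ε a ≤ L * (a - b) := h1
    _ ≤ max L 0 * (a - b) := mul_le_mul_of_nonneg_right (le_max_left _ _) hab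
    _ = max L 0 / ε A ^ θ * (a - b) * ε A ^ θ := by field_simp
    _ ≤ max L 0 / ε A ^ θ * (a - b) * max |ε b| |ε a| ^ θ := by
        apply mul_le_mul_of_nonneg_left hmax
        exact mul_nonneg (div_nonneg (le_max_right _ _) hmθ.le) hab

/-- `H(θ)` follows from the crux `DerivLeakage` for every `θ ≥ 0` (through RH). [folklore] -/
theorem holderLaw_of_derivLeakage {θ : ℝ} (hθ : 0 ≤ θ) (hD : DerivLeakage) :
    ∀ b₀ A : ℝ, 0 < b₀ → b₀ ≤ A → ∃ L : ℝ, ∀ b a : ℝ, b₀ ≤ b → b ≤ a → a ≤ A →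
      ε b - ε a ≤ L * (a - b) * max |ε b| |ε a| ^ θ :=
  holderLaw_of_riemannHypothesis hθ (riemannHypothesis_of_derivLeakage hD)

/-! ## 5. `H(θ) ⟹ S`: outright for `θ ≥ 1`, modulo transversality of conjugate points for `0 < θ < 1` -/

/-- **`H(θ) ⟹ RH` unconditionally for `θ ≥ 1`.** If RH fails, the first conjugate point `a⋆` of the flow
(`exists_conjugatePoint_sharp_of_not_riemannHypothesis`: `ε a⋆ = 0`, `ε > 0` before) and continuity of `ε`
at `a⋆` (`continuousAt_weilGroundEnergy`, Suzuki 2026 Thm 1.3, PROVED) give, for small `h > 0`,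
`y := ε(a⋆ − h) ∈ (0, 1)` and `y ≤ L h y^θ ≤ max L 0 · h · y`, i.e. `1 ≤ max L 0 · h` — absurd as `h → 0`.
No transversality is needed at this end of the ladder. [folklore] -/
theorem riemannHypothesis_of_holderLaw_of_one_le {θ : ℝ} (hθ : 1 ≤ θ)
    (hH : ∀ b₀ A : ℝ, 0 < b₀ → b₀ ≤ A → ∃ L : ℝ, ∀ b a : ℝ, b₀ ≤ b → b ≤ a → a ≤ A →
      ε b - ε a ≤ L * (a - b) * max |ε b| |ε a| ^ θ) : _root_.RiemannHypothesis := by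
  by_contra hRH
  obtain ⟨aStar, hgt, hzero, hbefore, -⟩ := exists_conjugatePoint_sharp_of_not_riemannHypothesis hRH
  have hlog : 0 < Real.log 2 / 2 := by
    have := Real.log_pos one_lt_two
    positivity
  have haS : 0 < aStar := hlog.trans hgt
  obtain ⟨L, hL⟩ := hH (aStar / 2) aStar (by positivity) (by linarith)
  -- continuity of `ε` at `a⋆`: `ε (a⋆ - h) → 0` as `h → 0⁺`
  have hcont : Tendsto (fun h : ℝ ↦ ε (aStar - h)) (𝓝[>] (0 : ℝ)) (𝓝 0) := by
    have h1 : Tendsto (fun h : ℝ ↦ aStar - h) (𝓝 (0 : ℝ)) (𝓝 (aStar - 0)) :=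
      tendsto_const_nhds.sub tendsto_id
    rw [sub_zero] at h1
    have h2 : Tendsto (fun h : ℝ ↦ ε (aStar - h)) (𝓝 (0 : ℝ)) (𝓝 (ε aStar)) :=
      (continuousAt_weilGroundEnergy haS).tendsto.comp h1
    rw [hzero] at h2
    exact h2.mono_left nhdsWithin_le_nhds
  have hev1 : ∀ᶠ h in 𝓝[>] (0 : ℝ), ε (aStar - h) < 1 := (tendsto_order.1 hcont).2 1 one_pos
  have hev2 : ∀ᶠ h in 𝓝[>] (0 : ℝ), h < aStar / 2 :=
    (eventually_lt_nhds (show (0 : ℝ) < aStar / 2 by positivity)).filter_mono nhdsWithin_le_nhds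
  have hev3 : ∀ᶠ h in 𝓝[>] (0 : ℝ), max L 0 * h < 1 := by
    have h1 : Tendsto (fun h : ℝ ↦ max L 0 * h) (𝓝 (0 : ℝ)) (𝓝 (max L 0 * 0)) :=
      tendsto_id.const_mul (max L 0)
    rw [mul_zero] at h1
    exact (tendsto_order.1 (h1.mono_left nhdsWithin_le_nhds)).2 1 one_pos
  have hev4 : ∀ᶠ h in 𝓝[>] (0 : ℝ), 0 < h := eventually_mem_nhdsWithin
  obtain ⟨h, ⟨⟨hy1, hhS⟩, hLh⟩, hh⟩ := (((hev1.and hev2).and hev3).and hev4).exists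
  -- the data at the pair `(b, a) = (a⋆ - h, a⋆)`
  set y : ℝ := ε (aStar - h) with hy
  have hypos : 0 < y := hbefore _ (by linarith) (by linarith)
  have hstep := hL (aStar - h) aStar (by linarith) (by linarith) le_rfl
  rw [hzero, sub_zero, abs_zero, abs_of_pos hypos, max_eq_left hypos.le,
    show aStar - (aStar - h) = h by ring] at hstep
  -- `hstep : y ≤ L * h * y ^ θ`, and `y ^ θ ≤ y` because `0 < y < 1 ≤ θ`
  have hyθ : y ^ θ ≤ y := by
    have := Real.rpow_le_rpow_of_exponent_ge hypos hy1.le hθ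
    rwa [Real.rpow_one] at this
  have hyθ0 : 0 ≤ y ^ θ := Real.rpow_nonneg hypos.le θ
  have hbound : y ≤ max L 0 * h * y :=
    calc y ≤ L * h * y ^ θ := hstep
      _ ≤ max L 0 * h * y ^ θ :=
          mul_le_mul_of_nonneg_right (mul_le_mul_of_nonneg_right (le_max_left _ _) hh.le) hyθ0
      _ ≤ max L 0 * h * y := mul_le_mul_of_nonneg_left hyθ (mul_nonneg (le_max_right _ _) hh.le)
  have hlt : max L 0 * h * y < 1 * y := mul_lt_mul_of_pos_right hLh hypos
  linarith

/-- **`H(θ) ⟹ RH` for `0 < θ < 1`, MODULO transversality of conjugate points** (Sub_0 of the strategist's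
census for item 1037: if the bottom vanishes at a window `a`, it does so with left slope `≤ −c < 0`; an
unconditional-flavoured Hopf/Hadamard non-degeneracy, closing nothing by itself). At the conjugate point
`a⋆` given by `¬RH` one gets `c h ≤ ε(a⋆ − h) ≤ L h ε(a⋆ − h)^θ`, whence `c^{1−θ} ≤ L h^θ → 0`, absurd.
(Kernel certificate of the forward seat fwd-rung-RiemannHypothesis-02, ported verbatim.) [folklore] -/
theorem riemannHypothesis_of_holderLaw_of_transversal {θ : ℝ} (hθ : 0 < θ) (hθ1 : θ < 1)
    (hH : ∀ b₀ A : ℝ, 0 < b₀ → b₀ ≤ A → ∃ L : ℝ, ∀ b a : ℝ, b₀ ≤ b → b ≤ a → a ≤ A →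
      ε b - ε a ≤ L * (a - b) * max |ε b| |ε a| ^ θ)
    (hT : ∀ a : ℝ, 0 < a → ε a = 0 → ∃ c : ℝ, 0 < c ∧ ∀ᶠ h in 𝓝[>] (0 : ℝ), c * h ≤ ε (a - h)) :
    _root_.RiemannHypothesis := by
  by_contra hRH
  obtain ⟨aStar, hgt, hzero, hbefore, -⟩ := exists_conjugatePoint_sharp_of_not_riemannHypothesis hRH
  have hlog : 0 < Real.log 2 / 2 := by
    have := Real.log_pos one_lt_two
    positivity
  have haS : 0 < aStar := hlog.trans hgt
  obtain ⟨c, hc, hev⟩ := hT aStar haS hzero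
  obtain ⟨L, hL⟩ := hH (aStar / 2) aStar (by positivity) (by linarith)
  -- eventually (in `𝓝[>] 0`): `L * h ^ θ < c ^ (1 - θ)` and `h < aStar / 2`
  have hcpow : 0 < c ^ (1 - θ) := Real.rpow_pos_of_pos hc _
  have htend : Tendsto (fun h : ℝ ↦ L * h ^ θ) (𝓝[>] (0 : ℝ)) (𝓝 0) := by
    have h1 : Tendsto (fun h : ℝ ↦ h ^ θ) (𝓝 (0 : ℝ)) (𝓝 ((0 : ℝ) ^ θ)) :=
      (Real.continuous_rpow_const hθ.le).continuousAt.tendsto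
    rw [Real.zero_rpow hθ.ne'] at h1
    simpa using (h1.mono_left nhdsWithin_le_nhds).const_mul L
  have hev2 : ∀ᶠ h in 𝓝[>] (0 : ℝ), L * h ^ θ < c ^ (1 - θ) :=
    (tendsto_order.1 htend).2 _ hcpow
  have hev3 : ∀ᶠ h in 𝓝[>] (0 : ℝ), h < aStar / 2 :=
    (eventually_lt_nhds (show (0 : ℝ) < aStar / 2 by positivity)).filter_mono nhdsWithin_le_nhds
  have hev4 : ∀ᶠ h in 𝓝[>] (0 : ℝ), 0 < h := eventually_mem_nhdsWithin
  obtain ⟨h, ⟨⟨hch, hLh⟩, hhS⟩, hh⟩ := ((hev.and hev2).and hev3).and hev4 |>.exists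
  -- the data at the pair `(b, a) = (aStar - h, aStar)`
  set y : ℝ := ε (aStar - h) with hy
  have hypos : 0 < y := hbefore _ (by linarith) (by linarith)
  have hstep := hL (aStar - h) aStar (by linarith) (by linarith) le_rfl
  rw [hzero, sub_zero, abs_zero, abs_of_pos hypos, max_eq_left hypos.le,
    show aStar - (aStar - h) = h by ring] at hstep
  -- `hstep : y ≤ L * h * y ^ θ`; lower bound `c * h ≤ y`
  have hyθ : 0 < y ^ θ := Real.rpow_pos_of_pos hypos θ
  have hsplit : y = y ^ (1 - θ) * y ^ θ := by
    rw [← Real.rpow_add hypos, sub_add_cancel, Real.rpow_one]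
  have h1 : y ^ (1 - θ) ≤ L * h := by
    have : y ^ (1 - θ) * y ^ θ ≤ L * h * y ^ θ := by rw [← hsplit]; exact hstep
    exact le_of_mul_le_mul_right this hyθ
  have h2 : (c * h) ^ (1 - θ) ≤ y ^ (1 - θ) :=
    Real.rpow_le_rpow (by positivity) hch (by linarith)
  have h3 : (c * h) ^ (1 - θ) = c ^ (1 - θ) * h ^ (1 - θ) := Real.mul_rpow hc.le hh.le
  have hh1θ : 0 < h ^ (1 - θ) := Real.rpow_pos_of_pos hh _
  have hhsplit : h = h ^ θ * h ^ (1 - θ) := by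
    rw [← Real.rpow_add hh, add_sub_cancel, Real.rpow_one]
  have h4 : c ^ (1 - θ) * h ^ (1 - θ) ≤ L * h ^ θ * h ^ (1 - θ) := by
    calc c ^ (1 - θ) * h ^ (1 - θ) = (c * h) ^ (1 - θ) := h3.symm
      _ ≤ y ^ (1 - θ) := h2
      _ ≤ L * h := h1
      _ = L * h ^ θ * h ^ (1 - θ) := by rw [mul_assoc, ← hhsplit]
  have h5 : c ^ (1 - θ) ≤ L * h ^ θ := le_of_mul_le_mul_right h4 hh1θ
  linarith

/-! ## 6. The calibrations of the ladder as equivalences -/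

/-- **For `θ ≥ 1` the rung IS the summit**: `H(θ) ↔ RiemannHypothesis`. [folklore] -/
theorem holderLaw_iff_riemannHypothesis_of_one_le {θ : ℝ} (hθ : 1 ≤ θ) :
    (∀ b₀ A : ℝ, 0 < b₀ → b₀ ≤ A → ∃ L : ℝ, ∀ b a : ℝ, b₀ ≤ b → b ≤ a → a ≤ A →
      ε b - ε a ≤ L * (a - b) * max |ε b| |ε a| ^ θ) ↔ _root_.RiemannHypothesis :=
  ⟨riemannHypothesis_of_holderLaw_of_one_le hθ,
    holderLaw_of_riemannHypothesis (zero_le_one.trans hθ)⟩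

/-- **For `θ ≥ 1` the rung IS the crux `DerivLeakage`** (item 14754): `H(θ) ↔ DerivLeakage`. [folklore] -/
theorem holderLaw_iff_derivLeakage_of_one_le {θ : ℝ} (hθ : 1 ≤ θ) :
    (∀ b₀ A : ℝ, 0 < b₀ → b₀ ≤ A → ∃ L : ℝ, ∀ b a : ℝ, b₀ ≤ b → b ≤ a → a ≤ A →
      ε b - ε a ≤ L * (a - b) * max |ε b| |ε a| ^ θ) ↔ DerivLeakage := by
  rw [holderLaw_iff_riemannHypothesis_of_one_le hθ, derivLeakage_iff_riemannHypothesis]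

/-- **For `0 < θ < 1` the rung is the summit MODULO transversality of conjugate points** (Sub_0):
given Sub_0, `H(θ) ↔ RiemannHypothesis`. [folklore] -/
theorem holderLaw_iff_riemannHypothesis_of_transversal {θ : ℝ} (hθ : 0 < θ) (hθ1 : θ < 1)
    (hT : ∀ a : ℝ, 0 < a → ε a = 0 → ∃ c : ℝ, 0 < c ∧ ∀ᶠ h in 𝓝[>] (0 : ℝ), c * h ≤ ε (a - h)) :
    (∀ b₀ A : ℝ, 0 < b₀ → b₀ ≤ A → ∃ L : ℝ, ∀ b a : ℝ, b₀ ≤ b → b ≤ a → a ≤ A →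
      ε b - ε a ≤ L * (a - b) * max |ε b| |ε a| ^ θ) ↔ _root_.RiemannHypothesis :=
  ⟨fun hH ↦ riemannHypothesis_of_holderLaw_of_transversal hθ hθ1 hH hT,
    holderLaw_of_riemannHypothesis hθ.le⟩

/-! ## 7. The lower slope pinch discharges transversality -/

/-- **A positive lower slope of `ε` on compact ranges discharges Sub_0**: a co-Lipschitz constant `ℓ > 0`
on `[a/2, a]` gives `ℓ h ≤ ε(a − h) − ε a = ε(a − h)` at a zero `a` of `ε`, for `0 < h < a/2`.
(The co-Lipschitz law is the quantitative form of the PROVED strict antitonicity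
`weilGroundEnergy_strictAntiOn`; it is not known even under RH.) [folklore] -/
theorem transversal_of_coLipschitz
    (hco : ∀ b₀ A : ℝ, 0 < b₀ → b₀ ≤ A → ∃ ℓ : ℝ, 0 < ℓ ∧ ∀ b a : ℝ, b₀ ≤ b → b ≤ a → a ≤ A →
      ℓ * (a - b) ≤ ε b - ε a) :
    ∀ a : ℝ, 0 < a → ε a = 0 → ∃ c : ℝ, 0 < c ∧ ∀ᶠ h in 𝓝[>] (0 : ℝ), c * h ≤ ε (a - h) := by
  intro a ha hzero
  obtain ⟨ℓ, hℓ, hlo⟩ := hco (a / 2) a (by positivity) (by linarith)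
  refine ⟨ℓ, hℓ, ?_⟩
  have hev3 : ∀ᶠ h in 𝓝[>] (0 : ℝ), h < a / 2 :=
    (eventually_lt_nhds (show (0 : ℝ) < a / 2 by positivity)).filter_mono nhdsWithin_le_nhds
  have hev4 : ∀ᶠ h in 𝓝[>] (0 : ℝ), 0 < h := eventually_mem_nhdsWithin
  filter_upwards [hev3, hev4] with h hh2 hh0
  have := hlo (a - h) a (by linarith) (by linarith) le_rfl
  rw [hzero, sub_zero, show a - (a - h) = h by ring] at this
  exact this

/-- Corollary: for `0 < θ < 1`, `H(θ)` together with a positive lower slope of `ε` on compact ranges gives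
the Riemann hypothesis — all unconditional content of the pair lives in the lower pinch. [folklore] -/
theorem riemannHypothesis_of_holderLaw_of_coLipschitz {θ : ℝ} (hθ : 0 < θ) (hθ1 : θ < 1)
    (hH : ∀ b₀ A : ℝ, 0 < b₀ → b₀ ≤ A → ∃ L : ℝ, ∀ b a : ℝ, b₀ ≤ b → b ≤ a → a ≤ A →
      ε b - ε a ≤ L * (a - b) * max |ε b| |ε a| ^ θ)
    (hco : ∀ b₀ A : ℝ, 0 < b₀ → b₀ ≤ A → ∃ ℓ : ℝ, 0 < ℓ ∧ ∀ b a : ℝ, b₀ ≤ b → b ≤ a → a ≤ A →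
      ℓ * (a - b) ≤ ε b - ε a) : _root_.RiemannHypothesis :=
  riemannHypothesis_of_holderLaw_of_transversal hθ hθ1 hH (transversal_of_coLipschitz hco)

end Summit.RiemannHypothesis.RiemannHypothesis.Theorems.WeilWindowFlowDerivLeakage

end
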